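import Literature.AlgebraicGeometry.Frobenioids.ModelFrobenioidPreFrobenioid
import Literature.AlgebraicGeometry.Frobenioids.PerfFactorialPrimes
import Literature.AnabelianGeometry.EtaleTheta.TemperedFrobenioidCnst
import Literature.AnabelianGeometry.EtaleTheta.Discharge.Sec3HullFaithful

/-!
# [EtTh] Definition 3.6 (iv) / Remark 3.6.3: `C^{bs-fld} → C` is faithful (unconditionally) and
# isomorphism-full with the printed description of the morphisms of its essential image — proofs

S. Mochizuki, *The étale theta function and its Frobenioid-theoretic manifestations*, Publ. RIMS **45**
(2009) [MochizukiEtTh2009], Definition 3.6 (iv), PDF p.78 (printed 304) ("a natural faithful functor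
`C^{bs-fld} → C`") and Remark 3.6.3, PDF pp.78–79 (printed 304–305) ("the essential image of the natural
functor `C^{bs-fld} → C` consists precisely of … the base-field-theoretic morphisms of `C` between objects
of the essential image. In particular, the natural functor `C^{bs-fld} → C` is isomorphism-full").

The statement files (abc-iut-L2-t3) are `TemperedFrobenioidHull.lean` (`hull`, named `Prop` `HullFaithful`)
and `TemperedFrobenioidProps.lean` (named `Prop` `Remark363 := IsIsomorphismFull C.hull ∧ ⟨morphism clause⟩`).
This PROOF-ONLY companion (abc-iut-w5-d135) proves:

* `hullFaithful_holds : C.HullFaithful` for EVERY tempered Frobenioid over ANY [FrdI] vocabulary `V` — no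
  cancellativity is needed (contrast `Sec3HullFaithful.hullFaithful_of_isCancelMul`): the
  `(Φ^{bs-fld})^gp`-component of the unit `u_φ = (b, ξ)` of a morphism `φ` of the model Frobenioid
  `C^{bs-fld}` is PINNED by the defining relation `deg_Fr(φ)·α + Div(φ) = Base(φ)^*β + Div_F(u_φ)` of
  [FrdI] Thm 5.2 (i), and `hull` is the identity on `b`, `deg_Fr`, `Base` and injective on `Div`.
* `remark363_of_isSharp` : `C.Remark363` for every tempered Frobenioid whose divisor monoids `Φ(A)` are
  sharp (no non-trivial units — automatic for the perf-factorial monoids of the text), GIVEN two printed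
  properties of the Definition 3.6 (i) data `(B₀^Λ, F₀^Λ ⊆ B₀^Λ, B₀^Λ → (Φ₀^ℝ)^gp)` that the abstract structure
  `RealifiedDivisorMonoids` does not record (its fields `BΛ`/`FΛ`/`divΛ` are free) — both in the binder shapes
  already in use on the cell's L2 board (`Sec3Cor38Criterion`, `Sec3Def36NonzeroConstants`):
  `hP34Λ : ∀ Y b r, Div(b) = r → b ∈ F₀^Λ(Y)` ("a `Λ`-log-meromorphic function with EFFECTIVE log-divisor is a
  constant", [EtTh] Prop. 3.4 (ii) p.74 — VERBATIM the typed field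
  `RealifiedDivisorMonoids.Prop34Cnst.mem_FΛ_of_divΛ_eq_of`, cell GAP-LEDGER G-w5d124-1/D-G-w5d124-1) and
  `hFinv : ∀ Y b, b ∈ F₀^Λ(Y) → ∃ b' ∈ F₀^Λ(Y), b'·b = 1` ("`F₀^Λ(Y)` is inverse-closed": `F₀(Y) ≅ L^×` is a
  group, Prop. 3.4 (ii) third isomorphism p.74; `F₀^ℚ = F₀^pf`, `F₀^ℝ = ℝ·Φ₀^cnst`, Def. 3.6 (i) p.76);
* `remark363_of_prop34Cnst` : at the tree's vocabulary `treeMonoidVocab` and over the typed Prop. 3.4 (ii)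
  structure `Prop34Cnst` (abc-iut-L2-t3), `Remark363` GIVEN `hFinv` alone.  `hFinv` is NECESSARY over the typed
  data (toy in that docstring); it is recorded on the cell GAP-LEDGER, never as a new `Prop` fact (D-0067).

Proof sketch (print: "follows from the definitions").  A morphism `φ : hull X → hull Y` of `C` has
`Div_B(u_φ) = ` the image of `ξ₀ := (Base(φ)^*β)⁻¹·α^{deg}·Div(φ) ∈ (Φ^{bs-fld})^gp` as soon as
`Div(φ) ∈ Φ^{bs-fld}` (the relation of [FrdI] Thm 5.2 (i) read in `Φ^gp`); `Φ^{bs-fld}(A)` being monoprime,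
`ξ₀ = z^{±1}` with `z ∈ Φ^{bs-fld}(A)`, so `Div(b^{±1}) = z` is effective and `b ∈ F₀^Λ` by `hP34Λ` (and `hFinv`
in the `−` case); then `(deg, Base, Div, (b, ξ₀))` is a morphism of `C^{bs-fld}` over `φ` (`exists_hull_map_eq`).  Isomorphisms of `C` have `deg_Fr = 1` and unit zero divisor, `= 1` by sharpness;
lifting `e.hom`, `e.inv` and gluing by faithfulness gives isomorphism-fullness; the morphism clause is the
same lift after transporting `f : A → B` along `A ≅ hull X`, `B ≅ hull Y` (zero divisors of isomorphisms
being trivial and `Φ^{bs-fld}` pull-back stable).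

HONEST FRAMING: refereed pre-IUT material ([EtTh] §3); nothing here bears on [IUTchIII] Cor. 3.12; no side
taken.  typed ≠ proved — these are proved, the two binders are displayed.
-/

namespace Literature.AnabelianGeometry.EtaleTheta

open CategoryTheory Opposite Literature.AlgebraicGeometry.Frobenioids Function

universe u₀ v₀ u₁ v₁ u v w

namespace TemperedFrobenioid

variable {D₀ : Type u₀} [Category.{v₀} D₀] {V : FrdIMonoidStub.{w}}
  {T : RealifiedDivisorMonoids (D₀ := D₀) V} {D : Type u} [Category.{v} D]
  {VD : FrdICatStub.{u, v, w} D} (C : TemperedFrobenioid T D VD)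

/-! ## Bookkeeping: the components of `Div_B`, `Div_F`, `hull` -/

/-- `Div_F(u) = ξ` for `u = (b, ξ) ∈ F^{bs}(A)`: the arrow `F^{bs} → (Φ^{bs-fld})^gp` of the hull data is
the second projection. [cite: MochizukiEtTh2009, Def 3.6 p.78] -/
theorem divB_hull_apply (A : Dᵒᵖ) (u : C.cnstFnBsFunctor.obj A) :
    Literature.AlgebraicGeometry.Frobenioids.divB C.bsFldMonoid C.cnstFnBsFunctor C.divFNatTrans A u =
      (Subtype.val u).2 := rfl

/-- `Div_B(u) = ξ` for `u = (b, ξ) ∈ B(A)`: the arrow `B → Φ^gp` of the tempered Frobenioid is the second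
projection. [cite: MochizukiEtTh2009, Def 3.6 p.77] -/
theorem divB_apply (A : Dᵒᵖ) (u : C.ratFnFunctor.obj A) :
    Literature.AlgebraicGeometry.Frobenioids.divB C.divisorMonoid C.ratFnFunctor C.divBNatTrans A u =
      (Subtype.val u).2 := rfl

/-- The defining equation of `B(A) = B₀^Λ ×_{(Φ^{ℝ-log})^gp} Φ^gp`: `Div(b) = ξ` in `(Φ^{ℝ-log})^gp(A)`.
[cite: MochizukiEtTh2009, Def 3.6 p.77] -/
theorem divΛ_fst_eq (A : Dᵒᵖ) (u : C.ratFnFunctor.obj A) :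
    T.divΛ (C.baseOp A) (Subtype.val u).1 =
      C.ΦgpToRlog A
        (Literature.AlgebraicGeometry.Frobenioids.divB C.divisorMonoid C.ratFnFunctor C.divBNatTrans A u) :=
  u.2

/-- `hull` is the identity on base objects. [cite: MochizukiEtTh2009, Def 3.6 p.78] -/
theorem hull_obj_base (X : C.hullCategory) : (C.hull.obj X).base = X.base := rfl

/-- Zero divisors of morphisms in the image of `hull` are base-field-theoretic.
[cite: MochizukiEtTh2009, Def 3.6 p.78] -/
theorem isBaseFieldTheoreticDiv_div_hull_map {X Y : C.hullCategory} (g : X ⟶ Y) :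
    C.IsBaseFieldTheoreticDiv (ModelFrobenioid.div (C.hull.map g)) :=
  (ModelFrobenioid.div g).2

/-- The image of `(Φ^{bs-fld}(A))^gp → (Φ^{ℝ-log})^gp(A)` lies in `ℝ·Φ₀^cnst` (a subgroup containing the
classes of the elements of `Φ^{bs-fld}(A)`). [cite: MochizukiEtTh2009, Def 3.6 p.77] -/
theorem bsFldGpToRlog_mem_cnstR (A : Dᵒᵖ) (ξ : Algebra.GrothendieckGroup (C.bsFld.carrier A)) :
    C.bsFldGpToRlog A ξ ∈ T.cnstR (C.baseOp A) := by
  induction ξ using Localization.induction_on with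
  | H q =>
    have hq : (Localization.mk q.1 q.2 : Algebra.GrothendieckGroup (C.bsFld.carrier A)) =
        Algebra.GrothendieckGroup.of q.1 / Algebra.GrothendieckGroup.of (q.2 : C.bsFld.carrier A) := by
      rw [eq_div_iff_mul_eq']
      change Localization.mk q.1 q.2 * Localization.mk (q.2 : C.bsFld.carrier A) 1 = Localization.mk q.1 1
      rw [Localization.mk_mul, Localization.mk_eq_mk_iff, Localization.r_iff_exists]
      exact ⟨1, by simp [mul_comm]⟩
    rw [hq, map_div]
    refine (T.cnstR (C.baseOp A)).div_mem ?_ ?_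
    · change gpMap (C.bsFld.carrier A).subtype (Algebra.GrothendieckGroup.of q.1) ∈ _
      rw [gpMap_of]
      exact q.1.2.2
    · change gpMap (C.bsFld.carrier A).subtype
        (Algebra.GrothendieckGroup.of (q.2 : C.bsFld.carrier A)) ∈ _
      rw [gpMap_of]
      exact (q.2 : C.bsFld.carrier A).2.2

/-- `Φ^{bs-fld}(A)` is monoprime (Def 3.6 (ii)(a)), so divisibility on it is total and every element of its
groupification is EFFECTIVE or ANTI-EFFECTIVE: `ξ = z` or `ξ = z⁻¹` with `z ∈ Φ^{bs-fld}(A)`.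
[cite: MochizukiEtTh2009, Def 3.6 p.77] -/
theorem exists_eq_of_or_eq_of_inv (A : Dᵒᵖ) (ξ : Algebra.GrothendieckGroup (C.bsFld.carrier A)) :
    ∃ z : C.bsFld.carrier A,
      ξ = Algebra.GrothendieckGroup.of z ∨ ξ = (Algebra.GrothendieckGroup.of z)⁻¹ := by
  have hM : IsMonoprime (C.bsFld.carrier A) := C.isMonoprime_bsFld A
  induction ξ using Localization.induction_on with
  | H q =>
    have hq : (Localization.mk q.1 q.2 : Algebra.GrothendieckGroup (C.bsFld.carrier A)) =
        Algebra.GrothendieckGroup.of q.1 / Algebra.GrothendieckGroup.of (q.2 : C.bsFld.carrier A) := by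
      rw [eq_div_iff_mul_eq']
      change Localization.mk q.1 q.2 * Localization.mk (q.2 : C.bsFld.carrier A) 1 = Localization.mk q.1 1
      rw [Localization.mk_mul, Localization.mk_eq_mk_iff, Localization.r_iff_exists]
      exact ⟨1, by simp [mul_comm]⟩
    rw [hq]
    rcases hM.dvd_total q.1 (q.2 : C.bsFld.carrier A) with ⟨z, hz⟩ | ⟨z, hz⟩
    · refine ⟨z, Or.inr ?_⟩
      rw [hz, map_mul, ← div_div, div_self', one_div]
    · refine ⟨z, Or.inl ?_⟩
      rw [hz, map_mul, mul_comm, mul_div_assoc, div_self', mul_one]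

/-- Hence the image of `ξ ∈ (Φ^{bs-fld}(A))^gp` in `(Φ^{ℝ-log})^gp(A)` is `z` or `z⁻¹` for an element
`z ∈ Φ^{bs-fld}(A) ⊆ Φ^{ℝ-log}(A)`. [cite: MochizukiEtTh2009, Def 3.6 p.77] -/
theorem exists_bsFldGpToRlog_eq_of_or_eq_of_inv (A : Dᵒᵖ)
    (ξ : Algebra.GrothendieckGroup (C.bsFld.carrier A)) :
    ∃ z : C.bsFld.carrier A,
      C.bsFldGpToRlog A ξ = Algebra.GrothendieckGroup.of (M := T.ΦR.obj (C.baseOp A)) (z : C.ΦRlog.obj A) ∨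
        C.bsFldGpToRlog A ξ =
          (Algebra.GrothendieckGroup.of (M := T.ΦR.obj (C.baseOp A)) (z : C.ΦRlog.obj A))⁻¹ := by
  obtain ⟨z, hz | hz⟩ := C.exists_eq_of_or_eq_of_inv A ξ
  · refine ⟨z, Or.inl ?_⟩
    rw [hz]
    exact gpMap_of _ _
  · refine ⟨z, Or.inr ?_⟩
    rw [hz, map_inv]
    exact congrArg (·⁻¹) (gpMap_of _ _)

/-! ## `C^{bs-fld} → C` is faithful — unconditionally -/

/-- In the model Frobenioid `C^{bs-fld}` the `(Φ^{bs-fld})^gp`-component `ξ = Div_F(u_φ)` of the unit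
`u_φ = (b, ξ)` of a morphism `φ : (A, α) → (B, β)` is determined by the other data:
`ξ = (Base(φ)^*β)⁻¹ · α^{deg_Fr(φ)} · Div(φ)` ([FrdI] Thm 5.2 (i), relation (d)).
[cite: MochizukiEtTh2009, Def 3.6 p.78] -/
theorem divF_unit_eq {X Y : C.hullCategory} (φ : X ⟶ Y) :
    Literature.AlgebraicGeometry.Frobenioids.divB C.bsFldMonoid C.cnstFnBsFunctor C.divFNatTrans _
        (ModelFrobenioid.unit φ) =
      (pullGp C.bsFldMonoid (ModelFrobenioid.baseMap φ) Y.cls)⁻¹ *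
        (X.cls ^ (ModelFrobenioid.degFr φ : ℕ) * Algebra.GrothendieckGroup.of (ModelFrobenioid.div φ)) :=
  eq_inv_mul_of_mul_eq (ModelFrobenioid.rel φ).symm

/-- **Definition 3.6 (iv): "a natural faithful functor `C^{bs-fld} → C`" — PROVED for every tempered
Frobenioid over any [FrdI] vocabulary** (no integrality hypothesis: `hull` is the identity on `deg_Fr`,
`Base` and on the `B₀^Λ`-component of units, injective on zero divisors, and the remaining unit component
is pinned by `divF_unit_eq`). [cite: MochizukiEtTh2009, Def 3.6 p.78] -/
theorem hullFaithful_holds : C.HullFaithful := by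
  refine ⟨fun {X Y} φ ψ h => ?_⟩
  have h1 : ModelFrobenioid.degFr φ = ModelFrobenioid.degFr ψ := by
    have h1' := congrArg ModelFrobenioid.Hom.degFr h
    exact h1'
  have h2 : ModelFrobenioid.baseMap φ = ModelFrobenioid.baseMap ψ := by
    have h2' := congrArg ModelFrobenioid.Hom.base h
    exact h2'
  have h3 : ModelFrobenioid.div φ = ModelFrobenioid.div ψ := by
    have h3' := congrArg ModelFrobenioid.Hom.div h
    exact C.bsFldInclM_injective _ h3'
  have h4 := congrArg (fun χ => Subtype.val (ModelFrobenioid.unit χ)) h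
  refine ModelFrobenioid.hom_ext h1 h2 h3 (Subtype.ext (Prod.ext ?_ ?_))
  · have h5 := congrArg Prod.fst h4
    exact h5
  · change Literature.AlgebraicGeometry.Frobenioids.divB C.bsFldMonoid C.cnstFnBsFunctor C.divFNatTrans _
          (ModelFrobenioid.unit φ) =
        Literature.AlgebraicGeometry.Frobenioids.divB C.bsFldMonoid C.cnstFnBsFunctor C.divFNatTrans _
          (ModelFrobenioid.unit ψ)
    simp only [divF_unit_eq, h1, h2, h3]

/-! ## Lifting morphisms of `C` with base-field-theoretic zero divisor along `hull` -/

section Lift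

variable {X Y : C.hullCategory}

/-- Relation (d) of [FrdI] Thm 5.2 (i) for a morphism `φ : hull X → hull Y` of `C` with base-field-theoretic
zero divisor, read in `Φ^gp`: with `ξ₀ := (Base(φ)^*β)⁻¹ · α^{deg_Fr(φ)} · Div(φ) ∈ (Φ^{bs-fld}(A))^gp`
one has `deg_Fr(φ)·α + Div(φ) = Base(φ)^*β + ξ₀` in `(Φ^{bs-fld})^gp` and `Div_B(u_φ)` is the image of `ξ₀` in
`Φ^gp`. [cite: MochizukiEtTh2009, Rmk 3.6.3 p.79] -/
theorem exists_xi_of_isBaseFieldTheoreticDiv (φ : C.hull.obj X ⟶ C.hull.obj Y)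
    (hdiv : C.IsBaseFieldTheoreticDiv (ModelFrobenioid.div φ)) :
    ∃ ξ₀ : Algebra.GrothendieckGroup (C.bsFldMonoid.obj (op X.base)),
      X.cls ^ (ModelFrobenioid.degFr φ : ℕ) *
          Algebra.GrothendieckGroup.of (M := C.bsFldMonoid.obj (op X.base))
            ⟨(ModelFrobenioid.div φ : C.Φ.carrier (op X.base)).1, hdiv⟩ =
        pullGp C.bsFldMonoid (X := X.base) (Y := Y.base) (ModelFrobenioid.baseMap φ :) Y.cls * ξ₀ ∧
      Literature.AlgebraicGeometry.Frobenioids.divB C.divisorMonoid C.ratFnFunctor C.divBNatTrans (op X.base)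
          (ModelFrobenioid.unit φ :) =
        C.bsFldInclGpM (op X.base) ξ₀ := by
  refine ⟨(pullGp C.bsFldMonoid (X := X.base) (Y := Y.base) (ModelFrobenioid.baseMap φ :) Y.cls)⁻¹ *
      (X.cls ^ (ModelFrobenioid.degFr φ : ℕ) *
        Algebra.GrothendieckGroup.of (M := C.bsFldMonoid.obj (op X.base))
          ⟨(ModelFrobenioid.div φ : C.Φ.carrier (op X.base)).1, hdiv⟩),
    (mul_inv_cancel_left _ _).symm, ?_⟩
  have h : C.bsFldInclGpM (op X.base) X.cls ^ (ModelFrobenioid.degFr φ : ℕ) *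
      Algebra.GrothendieckGroup.of (C.bsFldInclM (op X.base)
        (⟨(ModelFrobenioid.div φ : C.Φ.carrier (op X.base)).1, hdiv⟩ : C.bsFldMonoid.obj (op X.base))) =
    pullGp C.divisorMonoid (X := X.base) (Y := Y.base) (ModelFrobenioid.baseMap φ :)
        (C.bsFldInclGpM (op Y.base) Y.cls) *
      Literature.AlgebraicGeometry.Frobenioids.divB C.divisorMonoid C.ratFnFunctor C.divBNatTrans (op X.base)
        (ModelFrobenioid.unit φ :) :=
    ModelFrobenioid.rel φ
  rw [← bsFldInclGpM_of, ← bsFldInclGpM_pullGp, ← map_pow, ← map_mul] at h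
  rw [map_mul, map_inv]
  exact eq_inv_mul_of_mul_eq h.symm

/-- The `B₀^Λ`-component `b` of the unit `u_φ` of such a `φ` has log-divisor `Div(b) ∈ ℝ·Φ₀^cnst`.
[cite: MochizukiEtTh2009, Rmk 3.6.3 p.79] -/
theorem divΛ_fst_unit_mem_cnstR (φ : C.hull.obj X ⟶ C.hull.obj Y)
    (hdiv : C.IsBaseFieldTheoreticDiv (ModelFrobenioid.div φ)) :
    T.divΛ (C.baseOp (op X.base)) (Subtype.val (ModelFrobenioid.unit φ)).1 ∈ T.cnstR (C.baseOp (op X.base)) := by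
  obtain ⟨ξ₀, -, hξ⟩ := C.exists_xi_of_isBaseFieldTheoreticDiv φ hdiv
  have heq : T.divΛ (C.baseOp (op X.base)) (Subtype.val (ModelFrobenioid.unit φ)).1 =
      C.bsFldGpToRlog (op X.base) ξ₀ :=
    (C.divΛ_fst_eq (op X.base) (ModelFrobenioid.unit φ :)).trans
      ((congrArg (C.ΦgpToRlog (op X.base)) hξ).trans (C.ΦgpToRlog_bsFldInclGpM _ _))
  have hmem := C.bsFldGpToRlog_mem_cnstR (op X.base) ξ₀
  rw [← heq] at hmem
  exact hmem

/-- **The `B₀^Λ`-component of `u_φ` is CONSTANT** — GIVEN Prop 3.4 (ii) at monoid type `Λ`: `hP34Λ` ("a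
`Λ`-log-meromorphic function with EFFECTIVE log-divisor is constant" = the typed field
`RealifiedDivisorMonoids.Prop34Cnst.mem_FΛ_of_divΛ_eq_of`, cell GAP-LEDGER G-w5d124-1) and `hFinv`
("`F₀^Λ(Y) ≅ (L^×)^Λ` is inverse-closed", print p.74/p.76; the binder of `Sec3Def36NonzeroConstants`).  Indeed
`Div(b)` is the image of `ξ₀ ∈ (Φ^{bs-fld}(A))^gp`, which is `z` or `z⁻¹` with `z ∈ Φ^{bs-fld}(A)`
(`Φ^{bs-fld}(A)` being monoprime): in the first case `hP34Λ` applies to `b`, in the second to `b⁻¹`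
(`B₀^Λ` group-like) and `hFinv` returns to `b`. [cite: MochizukiEtTh2009, Rmk 3.6.3 p.79] -/
theorem fst_unit_mem_FΛ
    (hP34Λ : ∀ (Y : D₀ᵒᵖ) (b : T.BΛ.obj Y) (r : T.ΦR.obj Y),
      T.divΛ Y b = Algebra.GrothendieckGroup.of r → b ∈ T.FΛ Y)
    (hFinv : ∀ (Y : D₀ᵒᵖ) (b : T.BΛ.obj Y), b ∈ T.FΛ Y → ∃ b' ∈ T.FΛ Y, b' * b = 1)
    (φ : C.hull.obj X ⟶ C.hull.obj Y) (hdiv : C.IsBaseFieldTheoreticDiv (ModelFrobenioid.div φ)) :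
    ((Subtype.val (ModelFrobenioid.unit φ)).1 : T.BΛ.obj (C.baseOp (op X.base))) ∈ T.FΛ (C.baseOp (op X.base)) := by
  obtain ⟨ξ₀, -, hξ⟩ := C.exists_xi_of_isBaseFieldTheoreticDiv φ hdiv
  have heq : T.divΛ (C.baseOp (op X.base)) (Subtype.val (ModelFrobenioid.unit φ)).1 =
      C.bsFldGpToRlog (op X.base) ξ₀ :=
    (C.divΛ_fst_eq (op X.base) (ModelFrobenioid.unit φ :)).trans
      ((congrArg (C.ΦgpToRlog (op X.base)) hξ).trans (C.ΦgpToRlog_bsFldInclGpM _ _))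
  obtain ⟨z, hz | hz⟩ := C.exists_bsFldGpToRlog_eq_of_or_eq_of_inv (op X.base) ξ₀
  · exact hP34Λ _ _ _ (heq.trans hz)
  · -- anti-effective case: `b⁻¹` is constant by `hP34Λ`, hence so is `b` by `hFinv`
    obtain ⟨b', hb'⟩ :=
      (T.isUnit_BΛ (C.baseOp (op X.base)) (Subtype.val (ModelFrobenioid.unit φ)).1).exists_left_inv
    have hdivb' : T.divΛ (C.baseOp (op X.base)) b' =
        Algebra.GrothendieckGroup.of (M := T.ΦR.obj (C.baseOp (op X.base))) (z : C.ΦRlog.obj (op X.base)) := by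
      have h1 := congrArg (T.divΛ (C.baseOp (op X.base))) hb'
      rw [map_mul, map_one] at h1
      rw [eq_inv_of_mul_eq_one_left h1, heq, hz, inv_inv]
    obtain ⟨b'', hb''F, hb''⟩ := hFinv _ b' (hP34Λ _ _ _ hdivb')
    rw [← left_inv_eq_right_inv hb'' hb']
    exact hb''F

/-- **The lift.** A morphism `φ : hull X → hull Y` of `C` with base-field-theoretic zero divisor whose unit
has CONSTANT `B₀^Λ`-component `b ∈ F₀^Λ` is `hull` of the morphism `(deg_Fr(φ), Base(φ), Div(φ), (b, ξ₀))` of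
`C^{bs-fld}`. [cite: MochizukiEtTh2009, Rmk 3.6.3 p.79] -/
theorem exists_hull_map_eq_of_mem_FΛ (φ : C.hull.obj X ⟶ C.hull.obj Y)
    (hdiv : C.IsBaseFieldTheoreticDiv (ModelFrobenioid.div φ))
    (hb : (Subtype.val (ModelFrobenioid.unit φ)).1 ∈ T.FΛ (C.baseOp (op X.base))) :
    ∃ g : X ⟶ Y, C.hull.map g = φ := by
  obtain ⟨ξ₀, hrel, hξ⟩ := C.exists_xi_of_isBaseFieldTheoreticDiv φ hdiv
  have heq : T.divΛ (C.baseOp (op X.base)) (Subtype.val (ModelFrobenioid.unit φ)).1 =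
      C.bsFldGpToRlog (op X.base) ξ₀ :=
    (C.divΛ_fst_eq (op X.base) (ModelFrobenioid.unit φ :)).trans
      ((congrArg (C.ΦgpToRlog (op X.base)) hξ).trans (C.ΦgpToRlog_bsFldInclGpM _ _))
  refine ⟨ModelFrobenioid.mkHom X Y (ModelFrobenioid.degFr φ) (ModelFrobenioid.baseMap φ :)
    ⟨(ModelFrobenioid.div φ : C.Φ.carrier (op X.base)).1, hdiv⟩
    ⟨((Subtype.val (ModelFrobenioid.unit φ)).1, ξ₀), hb, heq⟩ ?_, ?_⟩
  · rw [divB_hull_apply]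
    exact hrel
  · exact ModelFrobenioid.hom_ext rfl rfl rfl (Subtype.ext (Prod.ext rfl hξ.symm))

/-- **The lift, GIVEN `hP34Λ` and `hFinv`** (see `fst_unit_mem_FΛ`): every morphism `hull X → hull Y` of `C`
with base-field-theoretic zero divisor lies in the image of `hull`.
[cite: MochizukiEtTh2009, Rmk 3.6.3 p.79] -/
theorem exists_hull_map_eq
    (hP34Λ : ∀ (Y : D₀ᵒᵖ) (b : T.BΛ.obj Y) (r : T.ΦR.obj Y),
      T.divΛ Y b = Algebra.GrothendieckGroup.of r → b ∈ T.FΛ Y)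
    (hFinv : ∀ (Y : D₀ᵒᵖ) (b : T.BΛ.obj Y), b ∈ T.FΛ Y → ∃ b' ∈ T.FΛ Y, b' * b = 1)
    (φ : C.hull.obj X ⟶ C.hull.obj Y) (hdiv : C.IsBaseFieldTheoreticDiv (ModelFrobenioid.div φ)) :
    ∃ g : X ⟶ Y, C.hull.map g = φ :=
  C.exists_hull_map_eq_of_mem_FΛ φ hdiv (C.fst_unit_mem_FΛ hP34Λ hFinv φ hdiv)

end Lift

/-! ## Zero divisors of composites with isomorphisms (sharp `Φ`) -/

/-- An isomorphism of `C` has zero divisor `1` when the divisor monoids are sharp ([FrdI] Thm 5.2 (ii)).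
[cite: MochizukiEtTh2009, Thm 3.7 p.79] -/
theorem div_eq_one_of_isIso_of_isSharp (hS : ∀ A : D, IsSharp (C.divisorMonoid.obj (op A)))
    {A B : C.category} (φ : A ⟶ B) [IsIso φ] : ModelFrobenioid.div φ = 1 :=
  (hS A.base).eq_one_of_isUnit _ (ElemFrobenioid.isUnit_div_of_isIso (C.toElem.map φ))

/-- Base-field-theoretic zero divisors are stable under pull-back (`Φ^{bs-fld}` is a subfunctor) — a local
copy of `Sec3CuspidalPreSteps.isBaseFieldTheoreticDiv_pull` (not imported: heavy). [cite: MochizukiEtTh2009, Def 3.6 p.77] -/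
private theorem isBaseFieldTheoreticDiv_pull' {A B : D} (h : A ⟶ B) {x : C.divisorMonoid.obj (op B)}
    (hx : C.IsBaseFieldTheoreticDiv x) : C.IsBaseFieldTheoreticDiv (pull C.divisorMonoid h x) :=
  C.bsFld.map_mem h.op _ hx

/-- Post-composing with an isomorphism does not change the zero divisor (sharp `Φ`).
[cite: MochizukiEtTh2009, Rmk 3.6.3 p.79] -/
theorem div_comp_iso (hS : ∀ A : D, IsSharp (C.divisorMonoid.obj (op A)))
    {A B B' : C.category} (f : A ⟶ B) (e : B ⟶ B') [IsIso e] :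
    ModelFrobenioid.div (f ≫ e) = ModelFrobenioid.div f := by
  rw [ModelFrobenioid.div_comp_pull, C.div_eq_one_of_isIso_of_isSharp hS e, map_one, one_mul,
    ModelFrobenioid.degFr_eq_one_of_isIso e, PNat.one_coe, pow_one]

/-- Pre-composing with an isomorphism pulls the zero divisor back (sharp `Φ`).
[cite: MochizukiEtTh2009, Rmk 3.6.3 p.79] -/
theorem div_iso_comp (hS : ∀ A : D, IsSharp (C.divisorMonoid.obj (op A)))
    {A' A B : C.category} (e : A' ⟶ A) [IsIso e] (f : A ⟶ B) :
    ModelFrobenioid.div (e ≫ f) =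
      pull C.divisorMonoid (ModelFrobenioid.baseMap e) (ModelFrobenioid.div f) := by
  rw [ModelFrobenioid.div_comp_pull, C.div_eq_one_of_isIso_of_isSharp hS e, one_pow, mul_one]

/-- Base-field-theoretic-ness of zero divisors is invariant under composing with isomorphisms on both
sides (sharp `Φ`). [cite: MochizukiEtTh2009, Rmk 3.6.3 p.79] -/
theorem isBaseFieldTheoreticDiv_iso_comp_comp_iso (hS : ∀ A : D, IsSharp (C.divisorMonoid.obj (op A)))
    {A' A B B' : C.category} (e₁ : A' ⟶ A) [IsIso e₁] (f : A ⟶ B) (e₂ : B ⟶ B') [IsIso e₂]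
    (hf : C.IsBaseFieldTheoreticDiv (ModelFrobenioid.div f)) :
    C.IsBaseFieldTheoreticDiv (ModelFrobenioid.div (e₁ ≫ f ≫ e₂)) := by
  rw [C.div_iso_comp hS, C.div_comp_iso hS]
  exact C.isBaseFieldTheoreticDiv_pull' _ hf

/-! ## Remark 3.6.3 -/

/-- **Isomorphism-fullness of `C^{bs-fld} → C`** (Rmk 3.6.3, "In particular …"), for sharp `Φ`, GIVEN
`hP34Λ` and `hFinv`. [cite: MochizukiEtTh2009, Rmk 3.6.3 p.79] -/
theorem isIsomorphismFull_hull (hS : ∀ A : D, IsSharp (C.divisorMonoid.obj (op A)))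
    (hP34Λ : ∀ (Y : D₀ᵒᵖ) (b : T.BΛ.obj Y) (r : T.ΦR.obj Y),
      T.divΛ Y b = Algebra.GrothendieckGroup.of r → b ∈ T.FΛ Y)
    (hFinv : ∀ (Y : D₀ᵒᵖ) (b : T.BΛ.obj Y), b ∈ T.FΛ Y → ∃ b' ∈ T.FΛ Y, b' * b = 1) :
    IsIsomorphismFull C.hull := by
  haveI : C.hull.Faithful := C.hullFaithful_holds
  refine ⟨inferInstance, fun X Y e => ?_⟩
  have hdiv : C.IsBaseFieldTheoreticDiv (ModelFrobenioid.div e.hom) := by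
    rw [C.div_eq_one_of_isIso_of_isSharp hS e.hom]
    exact (C.bsFld.carrier _).one_mem
  have hdiv' : C.IsBaseFieldTheoreticDiv (ModelFrobenioid.div e.inv) := by
    rw [C.div_eq_one_of_isIso_of_isSharp hS e.inv]
    exact (C.bsFld.carrier _).one_mem
  obtain ⟨g, hg⟩ := C.exists_hull_map_eq hP34Λ hFinv e.hom hdiv
  obtain ⟨g', hg'⟩ := C.exists_hull_map_eq hP34Λ hFinv e.inv hdiv'
  refine ⟨⟨g, g', C.hull.map_injective ?_, C.hull.map_injective ?_⟩, Iso.ext hg⟩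
  · rw [C.hull.map_comp, hg, hg', Iso.hom_inv_id, C.hull.map_id]
  · rw [C.hull.map_comp, hg, hg', Iso.inv_hom_id, C.hull.map_id]

/-- **Remark 3.6.3, morphism clause (⇒)**: a morphism of `C` abstractly equivalent to a morphism in the
image of `hull` is base-field-theoretic (sharp `Φ`; no further input). [cite: MochizukiEtTh2009, Rmk 3.6.3 p.79] -/
theorem isBaseFieldTheoretic_of_essImageHom (hS : ∀ A : D, IsSharp (C.divisorMonoid.obj (op A)))
    {A B : C.category} (f : A ⟶ B) (hf : essImageHom C.hull f) :
    C.IsBaseFieldTheoretic f := by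
  obtain ⟨X, Y, g, ⟨e⟩⟩ := hf
  have w : (Arrow.leftFunc.mapIso e).hom ≫ f = C.hull.map g ≫ (Arrow.rightFunc.mapIso e).hom :=
    Arrow.w e.hom
  have hf' : f = (Arrow.leftFunc.mapIso e).inv ≫ C.hull.map g ≫ (Arrow.rightFunc.mapIso e).hom :=
    (Iso.eq_inv_comp _).mpr w
  change C.IsBaseFieldTheoreticDiv (ModelFrobenioid.div f)
  rw [hf']
  exact C.isBaseFieldTheoreticDiv_iso_comp_comp_iso hS _ _ _ (C.isBaseFieldTheoreticDiv_div_hull_map g)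

/-- **Remark 3.6.3, morphism clause (⇐)**: a base-field-theoretic morphism of `C` between objects of the
essential image of `hull` is abstractly equivalent to a morphism in the image of `hull` (sharp `Φ`, GIVEN
`hP34Λ` and `hFinv`). [cite: MochizukiEtTh2009, Rmk 3.6.3 p.79] -/
theorem essImageHom_of_isBaseFieldTheoretic (hS : ∀ A : D, IsSharp (C.divisorMonoid.obj (op A)))
    (hP34Λ : ∀ (Y : D₀ᵒᵖ) (b : T.BΛ.obj Y) (r : T.ΦR.obj Y),
      T.divΛ Y b = Algebra.GrothendieckGroup.of r → b ∈ T.FΛ Y)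
    (hFinv : ∀ (Y : D₀ᵒᵖ) (b : T.BΛ.obj Y), b ∈ T.FΛ Y → ∃ b' ∈ T.FΛ Y, b' * b = 1)
    {A B : C.category} (f : A ⟶ B) (hA : essImageObj C.hull A) (hB : essImageObj C.hull B)
    (hf : C.IsBaseFieldTheoretic f) : essImageHom C.hull f := by
  let eA : C.hull.obj hA.witness ≅ A := hA.getIso
  let eB : C.hull.obj hB.witness ≅ B := hB.getIso
  have hdiv : C.IsBaseFieldTheoreticDiv (ModelFrobenioid.div (eA.hom ≫ f ≫ eB.inv)) :=
    C.isBaseFieldTheoreticDiv_iso_comp_comp_iso hS _ _ _ hf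
  obtain ⟨g, hg⟩ := C.exists_hull_map_eq hP34Λ hFinv (eA.hom ≫ f ≫ eB.inv) hdiv
  refine ⟨hA.witness, hB.witness, g, ⟨Arrow.isoMk' _ _ eA eB ?_⟩⟩
  rw [hg]
  simp

/-- **[EtTh] Remark 3.6.3 — `C.Remark363` PROVED for every tempered Frobenioid with sharp divisor monoids,
GIVEN Prop 3.4 (ii) at monoid type `Λ` (`hP34Λ`, the typed `Prop34Cnst.mem_FΛ_of_divΛ_eq_of`) and
inverse-closure of `F₀^Λ` (`hFinv`)** (module docstring). [cite: MochizukiEtTh2009, Rmk 3.6.3 p.79] -/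
theorem remark363_of_isSharp (hS : ∀ A : D, IsSharp (C.divisorMonoid.obj (op A)))
    (hP34Λ : ∀ (Y : D₀ᵒᵖ) (b : T.BΛ.obj Y) (r : T.ΦR.obj Y),
      T.divΛ Y b = Algebra.GrothendieckGroup.of r → b ∈ T.FΛ Y)
    (hFinv : ∀ (Y : D₀ᵒᵖ) (b : T.BΛ.obj Y), b ∈ T.FΛ Y → ∃ b' ∈ T.FΛ Y, b' * b = 1) :
    C.Remark363 :=
  ⟨C.isIsomorphismFull_hull hS hP34Λ hFinv, fun f hA hB =>
    ⟨C.isBaseFieldTheoretic_of_essImageHom hS f,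
      C.essImageHom_of_isBaseFieldTheoretic hS hP34Λ hFinv f hA hB⟩⟩

end TemperedFrobenioid

/-- **[EtTh] Remark 3.6.3 at the tree's [FrdI] vocabulary** `treeMonoidVocab`, over the typed Prop 3.4 (ii)
structure `RealifiedDivisorMonoids.Prop34Cnst` (abc-iut-L2-t3, `TemperedFrobenioidCnst.lean`): the divisor
monoids `Φ(A)` of a tempered Frobenioid are perf-factorial (Def 3.6 (ii)), hence divisorial, hence sharp, and
`hP34Λ` is the field `mem_FΛ_of_divΛ_eq_of` — so `Remark363` holds GIVEN only `hFinv` ("`F₀^Λ(Y)` is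
inverse-closed": `F₀(Y) ≅ L^×`, Prop 3.4 (ii) third isomorphism p.74; `F₀^ℚ = F₀^pf`, `F₀^ℝ = ℝ·Φ₀^cnst`,
Def 3.6 (i) p.76).  `hFinv` is NECESSARY over the typed data: with `B₀^Λ(Y) = ℤ ⊋ F₀^Λ(Y) = ℕ`,
`Φ = Φ^{ℝ-log} = ℕ` every typed field and `Prop34Cnst.mem_FΛ_of_divΛ_eq_of` hold while the isomorphism
`hull(A, 0) ⥲ hull(A, 1)` of `C` with unit `(-1, -1)` does not lift to `C^{bs-fld}`.
[cite: MochizukiEtTh2009, Rmk 3.6.3 p.79] -/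
theorem TemperedFrobenioid.remark363_of_prop34Cnst {D₀ : Type u₀} [Category.{v₀} D₀]
    {T : RealifiedDivisorMonoids (D₀ := D₀) treeMonoidVocab.{w}} {D : Type u} [Category.{v} D]
    {VD : FrdICatStub.{u, v, w} D} (C : TemperedFrobenioid T D VD)
    {Dcnst : Type u₁} [Category.{v₁} Dcnst] {cnst : D₀ ⥤ Dcnst} (hP : T.Prop34Cnst cnst)
    (hFinv : ∀ (Y : D₀ᵒᵖ) (b : T.BΛ.obj Y), b ∈ T.FΛ Y → ∃ b' ∈ T.FΛ Y, b' * b = 1) :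
    C.Remark363 :=
  C.remark363_of_isSharp (fun A => (C.isPerfFactorial (op A)).isDivisorial.isSharp)
    hP.mem_FΛ_of_divΛ_eq_of hFinv

/-- **[EtTh] Definition 3.6 (iv), faithfulness of `C^{bs-fld} → C`** — the named `Prop` `HullFaithful` holds
for every tempered Frobenioid over every vocabulary (restated at top level for the fact index).
[cite: MochizukiEtTh2009, Def 3.6 p.78] -/
theorem TemperedFrobenioid.hullFaithful_univ {D₀ : Type u₀} [Category.{v₀} D₀] {V : FrdIMonoidStub.{w}}
    {T : RealifiedDivisorMonoids (D₀ := D₀) V} {D : Type u} [Category.{v} D]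
    {VD : FrdICatStub.{u, v, w} D} (C : TemperedFrobenioid T D VD) : C.HullFaithful :=
  C.hullFaithful_holds

end Literature.AnabelianGeometry.EtaleTheta
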